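import Literature.NumberTheory.LFunctions.VinogradovKorobovNearZeroCount
import Literature.NumberTheory.LFunctions.VinogradovKorobovCotBound
import Literature.NumberTheory.LFunctions.FordLemma41
import HarnessLib

/-!
# Mossinghoff–Trudgian–Yang, Lemma 4.5 (Ford's Lemma 4.2): the zeros near `1 + it`, proved

Topic `Literature/NumberTheory/LFunctions`, family RH (explicit Vinogradov–Korobov zero-free
regions). Part of the decomposition of MTY's Lemma 4.7
(`Literature.NumberTheory.LFunctions.zero_inequality_mossinghoff_trudgian_yang`). Everything here
is PROVED; no named fact is introduced.

`VinogradovKorobovNearZeroCount.lean` reduced MTY's Lemma 4.5 — for `t ≥ 100`, `0 < R ≤ 1/4`,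
`N(t, R) ≤ 1.3478 R^{3/2} B log t + 3.777 + (log A − log R + (2/3) log log t)/1.879` (with the
honest constant `3.777` in place of the printed `0.479`, see that file) — to Ford's Lemma 4.1 (as
the predicate `FordLemma41 A B`) and Ford's (4.2) (`mty_lemma_4_5_of_ford41`). Meanwhile the tree
acquired Ford's zero detector for `ζ` on whole lines and Ford's Lemma 4.1 for *good* pairs
`(σ, η)` — no zero of `ζ` on `Re z = σ − η` — with the pole of `ζ` accounted for
(`FordLemma41.ford_lemma_4_1_of_good`, `η ≤ 1/2`), and Ford's (4.2) is proved in
`VinogradovKorobovCotBound.lean` (`ford_re_cot_ge`). This file closes Lemma 4.5 outright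
(`mty_lemma_4_5`, hypotheses: `RichertBound A B` with `A ≥ 6`, `B ≥ 0`; `mty_lemma_4_5_of_cot`
is the same with (4.2) kept as a hypothesis, for readers who want to see where it enters):

* `NearZeroCount.ford_lemma_4_1_of_good'` — `ford_lemma_4_1_of_good` with `η ≤ 3/4` in place of
  `η ≤ 1/2` (Lemma 4.5 takes `η = 2.5R ≤ 5/8`; Ford's Lemma 3.4 needs `2η/π ≤ 1/2` only);
* `NearZeroCount.near_count_core` — Ford's argument at the parameters `s' = 1 + 0.6421R' + it`,
  `η' = 2.5R'` of a *good* radius `R' ≥ R`, applied to the zeros of the disc `|1 + it − ρ| ≤ R`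
  (they have `Re (s' − ρ)/R' ≥ 0.6421`, `|(s' − ρ)/R' − 0.6421| ≤ R/R' ≤ 1`, so (4.2) applies):
  `0.3758 N(t,R)/R' ≤ 1/(0.6421R') + 0.6421R'/t² + (1/5R')(log A + B(1.8579R')^{3/2} log t`
  `+ (2/3) log log t + log ζ(1 + 3.1421R'))` (the second term is the pole of `ζ`, dropped in print);
* `NearZeroCount.exists_good_radius` — good radii are dense (the bad ones, `(1 − Re ρ)/1.8579`,
  are countably many), so `R' ↓ R` through good radii and the printed bound follows by continuity
  of the right side in `R'` (`mty_lemma_4_5`); the pole costs `≤ 1.1·10⁻⁵` of the slack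
  `3.777 − 3.77682`.

The printed proofs (Ford, Lemma 4.2; MTY, Lemma 4.5) apply Lemma 4.1 at `R` itself; Ford's
Lemma 4.1 removes bad lines by "a sequence of numbers `η'` tending to `η` from above", which here
would move the scale `2η/π` of the right-hand integral as well — perturbing the radius instead keeps
every step inside the landed lemmas.

## References

* K. Ford, *Zero-free regions for the Riemann zeta function*, Number Theory for the Millennium II
  (Urbana 2000), A K Peters 2002, 25–56 (arXiv:1910.08205): Lemma 4.1, Lemma 4.2 and (4.2).
  [Ford2002Millennium]
* M. J. Mossinghoff, T. S. Trudgian, A. Yang, *Explicit zero-free regions for the Riemann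
  zeta-function*, Res. Number Theory 10 (2024) (arXiv:2212.06867): Lemma 4.5, (4.10).
  [MossinghoffTrudgianYangRNT2024]
-/

noncomputable section

open Complex Real MeasureTheory Finset Set Filter
open scoped Topology
open Literature.Analysis.Complex.FordDetector (fordCot fordCot_neg)

namespace Literature.NumberTheory.LFunctions

namespace NearZeroCount

/-! ### Ford's Lemma 4.1 for good `(σ, η)`, `η ≤ 3/4` -/

/-- **Ford 2002, Lemma 4.1 for a good pair `(σ, η)`**, exactly as
`FordLemma41.ford_lemma_4_1_of_good` but with `η ≤ 3/4` (the proof there uses `η ≤ 1/2` only to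
ensure `2η/π ≤ 1/2` and `σ + η ≤ 3`). [cite: Ford2002Millennium, Lemma 4.1] -/
theorem ford_lemma_4_1_of_good' {A B σ t η : ℝ} (hA : 6 ≤ A) (hB : 0 ≤ B) (hR : RichertBound A B)
    (hη : 0 < η) (hη2 : η ≤ 3 / 4) (hσ : 1 ≤ σ) (hσ' : σ < 1 + η) (hleft : 1 / 2 ≤ σ - η)
    (ht : 100 ≤ t) (hexp : Real.exp (-(t / (2 * η / π))) ≤ 1 - σ + η)
    (hgood : ∀ ρ : ℂ, riemannZeta ρ = 0 → ρ.re ≠ σ - η)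
    (S : Finset ℂ) (hS : ∀ ρ ∈ S, riemannZeta ρ = 0 ∧ σ - η < ρ.re) :
    -(deriv riemannZeta (σ + t * I) / riemannZeta (σ + t * I)).re ≤
      (σ - 1) / ‖(σ : ℂ) + t * I - 1‖ ^ 2
      + (∑ ρ ∈ S, (riemannZetaZeroOrder ρ : ℝ) * (fordCot η (ρ - (σ + t * I))).re)
      + 1 / (2 * η) * (Real.log A + B * (1 - σ + η) ^ (3 / 2 : ℝ) * Real.log t
          + 2 / 3 * Real.log (Real.log t))
      - 1 / (4 * η) * fordLogZetaIntegral (σ + η) t (2 * η / π) := by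
  have ht0 : t ≠ 0 := by intro h; rw [h] at ht; norm_num at ht
  have hright : σ + η ≤ 3 := by linarith
  have h := FordZetaDetector.ford_zero_detector_zeta hη hσ hleft hright ht0 hgood S hS
  have eL : (∫ u : ℝ, Real.log ‖riemannZeta ((σ - η : ℝ) + ((t + u * (2 * η / π) : ℝ) : ℂ) * I)‖ /
      Real.cosh u ^ 2) = fordLogZetaIntegral (σ - η) t (2 * η / π) := rfl
  have eR : (∫ u : ℝ, Real.log ‖riemannZeta ((σ + η : ℝ) + ((t + u * (2 * η / π) : ℝ) : ℂ) * I)‖ /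
      Real.cosh u ^ 2) = fordLogZetaIntegral (σ + η) t (2 * η / π) := rfl
  rw [eL, eR] at h
  have ha : 0 < 2 * η / π := by positivity
  have ha2 : 2 * η / π ≤ 1 / 2 := by
    rw [div_le_iff₀ Real.pi_pos]
    have := Real.pi_gt_three
    nlinarith
  have hσ1 : σ - η < 1 := by linarith
  have hY : 0 ≤ B * (1 - (σ - η)) ^ (3 / 2 : ℝ) := mul_nonneg hB (Real.rpow_nonneg (by linarith) _)
  have hL := fordLogZetaIntegral_le_of_zeta_bound' (σ := σ - η) (X := A)
    (Y := B * (1 - (σ - η)) ^ (3 / 2 : ℝ)) (Z := 2 / 3) hleft hσ1 (by linarith) hY (by norm_num)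
    (by norm_num; linarith [hY]) (zeta_bound_of_richertBound hA hB hR hleft hσ1.le) ha ha2 ht
    (by rw [show 1 - (σ - η) = 1 - σ + η by ring]; exact hexp)
  rw [show 1 - (σ - η) = 1 - σ + η by ring] at hL
  have hη4 : 0 < 1 / (4 * η) := by positivity
  have key := mul_le_mul_of_nonneg_left hL hη4.le
  have e : 1 / (4 * η) * (2 * (Real.log A + B * (1 - σ + η) ^ (3 / 2 : ℝ) * Real.log t
      + 2 / 3 * Real.log (Real.log t))) = 1 / (2 * η) * (Real.log A + B * (1 - σ + η) ^ (3 / 2 : ℝ) *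
        Real.log t + 2 / 3 * Real.log (Real.log t)) := by
    field_simp; ring
  rw [e] at key
  rw [mul_sub] at h
  linarith

/-! ### The core inequality at a good radius -/

/-- **Ford's argument for Lemma 4.2 at a good radius `R' ≥ R`.** Assume `RichertBound A B`
(`A ≥ 6`, `B ≥ 0`), Ford's (4.2) (hypothesis `hcot`), `t ≥ 100`, `0 < R ≤ R' ≤ 1/4 + 3/10000`, and
that no zero of `ζ` lies on `Re z = 1 − 1.8579R'`. With `s' = 1 + 0.6421R' + it`, `η' = 2.5R'`
and `S` the zeros of the disc `|1 + it − ρ| ≤ R` in Lemma 4.1 (`ford_lemma_4_1_of_good'`):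
the left side is `≥ −1/(0.6421R')` (Ford (3.6), `norm_deriv_riemannZeta_div_lt`), each zero of the
disc enters with `−m(ρ) Re (π/5R')cot(π(s'−ρ)/5R') ≤ −0.3758 m(ρ)/R'` by (4.2), the right-hand
integral is `≥ −2 log ζ(1 + 3.1421R')` (`fordLogZetaIntegral_ge`), and the pole contributes
`0.6421R'/|s' − 1|² ≤ 0.6421R'/t²`. [cite: Ford2002Millennium, proof of Lemma 4.2]
[cite: MossinghoffTrudgianYangRNT2024, proof of Lemma 4.5, (4.10)] -/
theorem near_count_core {A B t R R' : ℝ} (hA : 6 ≤ A) (hB : 0 ≤ B) (hRB : RichertBound A B)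
    (hcot : ∀ z : ℂ, 0.6421 ≤ z.re → ‖z - 0.6421‖ ≤ 1 →
      0.3758 ≤ (((π / 5 : ℝ) : ℂ) * Complex.cot (((π / 5 : ℝ) : ℂ) * z)).re)
    (ht : 100 ≤ t) (hR : 0 < R) (hRR' : R ≤ R') (hR'1 : R' ≤ 0.2503)
    (hgood : ∀ ρ : ℂ, riemannZeta ρ = 0 → ρ.re ≠ 1 - 1.8579 * R') :
    0.3758 / R' * fordN t R ≤ 1 / (0.6421 * R') + 0.6421 * R' / t ^ 2
      + 1 / (5 * R') * (Real.log A + B * (1.8579 * R') ^ (3 / 2 : ℝ) * Real.log t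
          + 2 / 3 * Real.log (Real.log t))
      + 1 / (5 * R') * Real.log ((riemannZeta ((1 + 3.1421 * R' : ℝ) : ℂ)).re) := by
  classical
  have hR' : 0 < R' := lt_of_lt_of_le hR hRR'
  set σ : ℝ := 1 + 0.6421 * R' with hσ
  set η : ℝ := 5 / 2 * R' with hη
  have hη0 : 0 < η := by positivity
  -- the disc zeros qualify (strictly to the right of `Re z = σ − η = 1 − 1.8579R'`)
  have hmem : ∀ ρ ∈ fordNearZeros t R, riemannZeta ρ = 0 ∧ σ - η < ρ.re := by
    intro ρ hρ
    rw [mem_fordNearZeros] at hρ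
    have hre := Complex.abs_re_le_norm (1 + t * I - ρ)
    simp only [Complex.sub_re, Complex.add_re, Complex.one_re, Complex.mul_re, Complex.ofReal_re,
      Complex.I_re, mul_zero, Complex.ofReal_im, Complex.I_im, mul_one, sub_self, add_zero] at hre
    rw [abs_le] at hre
    refine ⟨hρ.1, ?_⟩
    rw [hσ, hη]; nlinarith [hre.1, hre.2, hρ.2]
  have hexp : Real.exp (-(t / (2 * η / π))) ≤ 1 - σ + η := by
    have hx : 0 < t / (2 * η / π) := by positivity
    refine (FordLemma41.exp_neg_le_one_div hx).trans ?_
    rw [hσ, hη, div_le_iff₀ hx]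
    have hπ := Real.pi_gt_three
    have h1 : t / (2 * (5 / 2 * R') / π) = π * t / (5 * R') := by field_simp
    rw [h1]
    have h2 : (1 - (1 + 0.6421 * R') + 5 / 2 * R') * (π * t / (5 * R')) = 1.8579 * (π * t / 5) := by
      field_simp; ring
    rw [h2]; nlinarith
  have h := ford_lemma_4_1_of_good' hA hB hRB hη0 (by rw [hη]; linarith) (by rw [hσ]; linarith)
    (by rw [hσ, hη]; linarith) (by rw [hσ, hη]; linarith) ht hexp
    (fun ρ hρ ↦ by rw [show σ - η = 1 - 1.8579 * R' by rw [hσ, hη]; ring]; exact hgood ρ hρ)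
    (fordNearZeros t R) hmem
  -- (i) the left side `≥ −1/(0.6421R')`
  have hlhs : -(1 / (0.6421 * R')) ≤ -(deriv riemannZeta (σ + t * I) / riemannZeta (σ + t * I)).re := by
    have hs : 1 < ((σ : ℂ) + t * I).re := by simp [hσ]; positivity
    have h1 := norm_deriv_riemannZeta_div_lt hs
    have e : ((σ : ℂ) + t * I).re - 1 = 0.6421 * R' := by simp [hσ]
    rw [e] at h1
    have h2 := Complex.re_le_norm (deriv riemannZeta (σ + t * I) / riemannZeta (σ + t * I))
    linarith
  -- (ii) the pole term `≤ 0.6421R'/t²`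
  have hpole : (σ - 1) / ‖(σ : ℂ) + t * I - 1‖ ^ 2 ≤ 0.6421 * R' / t ^ 2 := by
    have e1 : σ - 1 = 0.6421 * R' := by rw [hσ]; ring
    have e2 : ‖(σ : ℂ) + t * I - 1‖ ^ 2 = (0.6421 * R') ^ 2 + t ^ 2 := by
      rw [Complex.sq_norm, Complex.normSq_apply]
      simp [hσ]
      ring
    rw [e1, e2]
    have ht2 : (0 : ℝ) < t ^ 2 := by positivity
    exact div_le_div_of_nonneg_left (by positivity) ht2 (by nlinarith)
  -- (iii) the cot terms: `Re h_η(ρ − s') ≤ −0.3758/R'` on the disc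
  have hcotρ : ∀ ρ ∈ fordNearZeros t R, (fordCot η (ρ - (σ + t * I))).re ≤ -(0.3758 / R') := by
    intro ρ hρ
    rw [mem_fordNearZeros] at hρ
    have hre1 : ρ.re < 1 := by
      by_contra hle
      exact riemannZeta_ne_zero_of_one_le_re (not_lt.1 hle) hρ.1
    set z : ℂ := ((σ : ℂ) + t * I - ρ) / (R' : ℂ) with hz
    have hRC : (R' : ℂ) ≠ 0 := by exact_mod_cast hR'.ne'
    have ecoef : ((π / (2 * η) : ℝ) : ℂ) = ((1 / R' : ℝ) : ℂ) * ((π / 5 : ℝ) : ℂ) := by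
      rw [hη]; push_cast; field_simp
    have earg : ((π / (2 * η) : ℝ) : ℂ) * ((σ : ℂ) + t * I - ρ) = ((π / 5 : ℝ) : ℂ) * z := by
      rw [ecoef, hz]; push_cast; field_simp
    have hzre : 0.6421 ≤ z.re := by
      rw [hz, Complex.div_ofReal_re]
      simp only [Complex.sub_re, Complex.add_re, Complex.ofReal_re, Complex.mul_re, Complex.I_re,
        mul_zero, Complex.ofReal_im, Complex.I_im, mul_one, sub_self, add_zero]
      rw [hσ, le_div_iff₀ hR']; nlinarith
    have hznorm : ‖z - 0.6421‖ ≤ 1 := by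
      have e : z - 0.6421 = (1 + t * I - ρ) / (R' : ℂ) := by
        rw [hz, hσ]; push_cast; field_simp; ring
      rw [e, norm_div, Complex.norm_real, Real.norm_eq_abs, abs_of_pos hR', div_le_one hR']
      exact hρ.2.trans hRR'
    have hc := hcot z hzre hznorm
    have hneg : fordCot η (ρ - (σ + t * I)) = -fordCot η ((σ : ℂ) + t * I - ρ) := by
      rw [← fordCot_neg]; congr 1; ring
    rw [hneg, Complex.neg_re, neg_le_neg_iff]
    show 0.3758 / R' ≤ (((π / (2 * η) : ℝ) : ℂ) * Complex.cot (((π / (2 * η) : ℝ) : ℂ) * (σ + t * I - ρ))).re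
    rw [earg, ecoef, mul_assoc, Complex.re_ofReal_mul]
    rw [div_eq_mul_inv, mul_comm, ← one_div]
    exact mul_le_mul_of_nonneg_left hc (by positivity)
  have hsum : (∑ ρ ∈ fordNearZeros t R, (riemannZetaZeroOrder ρ : ℝ) * (fordCot η (ρ - (σ + t * I))).re)
      ≤ -(0.3758 / R' * fordN t R) := by
    unfold fordN
    rw [Finset.mul_sum, ← Finset.sum_neg_distrib]
    refine Finset.sum_le_sum fun ρ hρ ↦ ?_
    have hm : (0 : ℝ) ≤ riemannZetaZeroOrder ρ := by
      have hz0 := (mem_fordNearZeros.1 hρ).1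
      exact_mod_cast riemannZetaZeroOrder_nonneg fun h1 ↦ riemannZeta_one_ne_zero (h1 ▸ hz0)
    have := mul_le_mul_of_nonneg_left (hcotρ ρ hρ) hm
    linarith
  -- (iv) the integral term
  have hση : σ + η = 1 + 3.1421 * R' := by rw [hσ, hη]; ring
  have hint : -(1 / (4 * η) * fordLogZetaIntegral (σ + η) t (2 * η / π))
      ≤ 1 / (2 * η) * Real.log ((riemannZeta ((1 + 3.1421 * R' : ℝ) : ℂ)).re) := by
    have h1 := fordLogZetaIntegral_ge (σ' := σ + η) (by rw [hση]; linarith) t (2 * η / π)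
    rw [hση] at h1 ⊢
    have h4η : 0 < 1 / (4 * η) := by positivity
    have e : 1 / (2 * η) = 2 * (1 / (4 * η)) := by field_simp; ring
    rw [e]
    nlinarith
  -- assemble
  have hrich : 1 - σ + η = 1.8579 * R' := by rw [hσ, hη]; ring
  have h2η : 1 / (2 * η) = 1 / (5 * R') := by rw [hη]; ring
  rw [hrich, h2η] at h
  rw [h2η] at hint
  linarith [h, hlhs, hpole, hsum, hint]

/-! ### Good radii -/

/-- Off the countably many radii `(1 − Re ρ)/1.8579`: for `0 ≤ R₁ < R₂ ≤ 1/2` there is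
`R' ∈ (R₁, R₂)` with no zero of `ζ` on the line `Re z = 1 − 1.8579R'`. [folklore] -/
theorem exists_good_radius {R₁ R₂ : ℝ} (h₁ : 0 ≤ R₁) (h₁₂ : R₁ < R₂) (h₂ : R₂ ≤ 1 / 2) :
    ∃ R' : ℝ, R₁ < R' ∧ R' < R₂ ∧ ∀ ρ : ℂ, riemannZeta ρ = 0 → ρ.re ≠ 1 - 1.8579 * R' := by
  set Bad : Set ℝ := (fun ρ : ℂ ↦ (1 - ρ.re) / 1.8579) '' ZetaZeros.riemannZetaNontrivialZeros
    with hBad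
  have hcount : Bad.Countable := riemannZetaNontrivialZeros_countable.image _
  have hT : ¬ (Ioo R₁ R₂ ⊆ Bad) := by
    intro hsub
    have h0 : volume (Ioo R₁ R₂) = 0 := measure_mono_null hsub (hcount.measure_zero volume)
    rw [Real.volume_Ioo] at h0
    have : ENNReal.ofReal (R₂ - R₁) ≠ 0 := by
      rw [ENNReal.ofReal_ne_zero_iff]; linarith
    exact this h0
  obtain ⟨R', hR'T, hR'B⟩ := not_subset.1 hT
  refine ⟨R', hR'T.1, hR'T.2, fun ρ hρ hre ↦ hR'B ?_⟩
  have hρre1 : 0 < ρ.re := by rw [hre]; nlinarith [hR'T.2]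
  have hρre2 : ρ.re < 1 := by rw [hre]; nlinarith [hR'T.1]
  refine ⟨ρ, (mem_riemannZetaNontrivialZeros_iff_holds).2 ⟨hρ, hρre1, hρre2⟩, ?_⟩
  simp only
  rw [hre]; field_simp; ring

/-- `log ζ(1 + 3.1421R) ≤ −log R − 0.6903` for `0 < R ≤ 1/4 + 3/10000` (the range of
`log_zeta_ramare_bound` slightly extended, for the perturbation of the radius; Ramaré's (3.2) and
`log 3.1421 > 1.1443`). [cite: MossinghoffTrudgianYangRNT2024, (3.2) and (4.10)] -/
theorem log_zeta_ramare_bound' {R : ℝ} (hR : 0 < R) (hR4 : R ≤ 0.2503) :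
    Real.log ((riemannZeta ((1 + 3.1421 * R : ℝ) : ℂ)).re) ≤ -Real.log R - 0.6903 := by
  have hσ : 1 < 1 + 3.1421 * R := by linarith
  have hram := zeta_real_le_ramare_holds (1 + 3.1421 * R) hσ
  have hZ : 0 < (riemannZeta ((1 + 3.1421 * R : ℝ) : ℂ)).re := by linarith [one_le_re_zeta hσ]
  have e1 : 1 + 3.1421 * R - 1 = 3.1421 * R := by ring
  rw [e1] at hram
  have h1 := Real.log_le_log hZ hram
  rw [Real.log_div (Real.exp_pos _).ne' (by positivity), Real.log_exp,
    Real.log_mul (by norm_num) hR.ne'] at h1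
  have hγ := Literature.Analysis.SpecialFunctions.Real.eulerMascheroniConstant_lt_d8
  have hγ0 : 0 < Real.eulerMascheroniConstant := by
    linarith [Literature.Analysis.SpecialFunctions.Real.eulerMascheroniConstant_gt_d8]
  have hlog : (1.1443 : ℝ) ≤ Real.log 3.1421 := by
    have he := Real.exp_one_lt_d9
    have he0 := Real.exp_pos (1 : ℝ)
    have hq : (1.1559139 : ℝ) ≤ 3.1421 / Real.exp 1 := by
      rw [le_div_iff₀ he0]; nlinarith
    have hy : (0.1443 : ℝ) ≤ Real.log 1.1559139 := by
      have h := Real.abs_log_sub_add_sum_range_le (x := (-0.1559139 : ℝ)) (by norm_num) 3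
      simp only [Finset.sum_range_succ, Finset.sum_range_zero] at h
      norm_num at h
      rw [abs_le] at h
      linarith [h.1, h.2]
    have h3 : Real.log 3.1421 = 1 + Real.log (3.1421 / Real.exp 1) := by
      rw [Real.log_div (by norm_num) he0.ne', Real.log_exp]; ring
    rw [h3]
    have := Real.log_le_log (by norm_num) hq
    linarith
  nlinarith [hγ, hγ0, hlog, hR]

end NearZeroCount

open NearZeroCount

/-- **Mossinghoff–Trudgian–Yang, Lemma 4.5 (Ford's Lemma 4.2), proved** — with the constant
`3.777` that the printed argument yields (see `VinogradovKorobovNearZeroCount.lean`; the printed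
`0.479` rests on a bound for `ζ'/ζ` at the wrong abscissa): assume (3.1) in the form
`RichertBound A B` with `A ≥ 6`, `B ≥ 0`, and Ford's (4.2) (hypothesis `hcot`, proved as
`ford_re_cot_ge` in `VinogradovKorobovCotBound.lean`). Then for `t ≥ 100` and `0 < R ≤ 1/4`,
`N(t, R) ≤ 1.3478 R^{3/2} B log t + 3.777 + (log A − log R + (2/3) log log t)/1.879`.
Proof: `near_count_core` at good radii `R' ↓ R` (`exists_good_radius`), Ramaré's (3.2)
(`log_zeta_ramare_bound'`), continuity of the resulting bound in `R'`, and
`(1/0.6421 − 0.6903/5)/0.3758 + 0.6421R²/(0.3758t²) ≤ 3.777`, `1.8579^{3/2}/1.879 ≤ 1.3478`.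
[cite: MossinghoffTrudgianYangRNT2024, Lemma 4.5] [cite: Ford2002Millennium, Lemma 4.2] -/
theorem mty_lemma_4_5_of_cot {A B : ℝ} (hA : 6 ≤ A) (hB : 0 ≤ B) (hRB : RichertBound A B)
    (hcot : ∀ z : ℂ, 0.6421 ≤ z.re → ‖z - 0.6421‖ ≤ 1 →
      0.3758 ≤ (((π / 5 : ℝ) : ℂ) * Complex.cot (((π / 5 : ℝ) : ℂ) * z)).re)
    {t R : ℝ} (ht : 100 ≤ t) (hR : 0 < R) (hR4 : R ≤ 1 / 4) :
    fordN t R ≤ 1.3478 * R ^ (3 / 2 : ℝ) * B * Real.log t + 3.777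
      + (Real.log A - Real.log R + 2 / 3 * Real.log (Real.log t)) / 1.879 := by
  set L : ℝ := Real.log t with hL
  set LL : ℝ := Real.log (Real.log t) with hLL
  have hL0 : 0 ≤ L := Real.log_nonneg (by linarith)
  have ht0 : 0 < t := by linarith
  -- the bound at a good radius `R'`, multiplied through by `R'/0.3758`
  set Ψ : ℝ → ℝ := fun r ↦ (1 / 0.6421 + 0.6421 * r ^ 2 / t ^ 2
      + 1 / 5 * (Real.log A + B * (1.8579 * r) ^ (3 / 2 : ℝ) * L + 2 / 3 * LL)
      + 1 / 5 * (-Real.log r - 0.6903)) / 0.3758 with hΨ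
  have hstep : ∀ R' : ℝ, R ≤ R' → R' ≤ 0.2503 →
      (∀ ρ : ℂ, riemannZeta ρ = 0 → ρ.re ≠ 1 - 1.8579 * R') → fordN t R ≤ Ψ R' := by
    intro R' hRR' hR'1 hgood
    have hR' : 0 < R' := lt_of_lt_of_le hR hRR'
    have hcore := near_count_core hA hB hRB hcot ht hR hRR' hR'1 hgood
    have hram := log_zeta_ramare_bound' hR' hR'1
    have h5 : 0 < 1 / (5 * R') := by positivity
    have hkey : 0.3758 / R' * fordN t R ≤ 1 / (0.6421 * R') + 0.6421 * R' / t ^ 2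
        + 1 / (5 * R') * (Real.log A + B * (1.8579 * R') ^ (3 / 2 : ℝ) * L + 2 / 3 * LL)
        + 1 / (5 * R') * (-Real.log R' - 0.6903) := by
      nlinarith [hcore, mul_le_mul_of_nonneg_left hram h5.le]
    have hmul := mul_le_mul_of_nonneg_right hkey (show (0 : ℝ) ≤ R' / 0.3758 by positivity)
    have e1 : 0.3758 / R' * fordN t R * (R' / 0.3758) = fordN t R := by field_simp
    have e2 : (1 / (0.6421 * R') + 0.6421 * R' / t ^ 2
        + 1 / (5 * R') * (Real.log A + B * (1.8579 * R') ^ (3 / 2 : ℝ) * L + 2 / 3 * LL)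
        + 1 / (5 * R') * (-Real.log R' - 0.6903)) * (R' / 0.3758) = Ψ R' := by
      rw [hΨ]; field_simp
    rw [e1, e2] at hmul
    exact hmul
  -- continuity of `Ψ` at `R`
  have hΨc : ContinuousAt Ψ R := by
    have h1 : ContinuousAt (fun r : ℝ ↦ (1.8579 * r) ^ (3 / 2 : ℝ)) R :=
      ((Real.continuous_rpow_const (by norm_num)).comp (continuous_const.mul continuous_id)).continuousAt
    have h2 : ContinuousAt (fun r : ℝ ↦ Real.log r) R := Real.continuousAt_log hR.ne'
    have h3 : ContinuousAt (fun r : ℝ ↦ r ^ 2) R := (continuous_pow 2).continuousAt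
    rw [hΨ]
    exact ((((continuousAt_const.add ((continuousAt_const.mul h3).div_const _)).add
      (continuousAt_const.mul ((continuousAt_const.add ((continuousAt_const.mul h1).mul
        continuousAt_const)).add continuousAt_const))).add
      (continuousAt_const.mul ((h2.neg).sub continuousAt_const))).div_const _)
  -- `N(t, R) ≤ Ψ(R)` by letting good radii decrease to `R`
  have hmain : fordN t R ≤ Ψ R := by
    refine le_of_forall_pos_le_add fun ε hε ↦ ?_
    obtain ⟨δ, hδ, hδΨ⟩ := Metric.continuousAt_iff.1 hΨc ε hε
    have hgap : R < min (R + δ) 0.2503 := lt_min (by linarith) (by linarith)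
    obtain ⟨R', hR'1, hR'2, hgood⟩ := exists_good_radius hR.le hgap
      ((min_le_right _ _).trans (by norm_num))
    have hR'δ : R' < R + δ := lt_of_lt_of_le hR'2 (min_le_left _ _)
    have hR'c : R' ≤ 0.2503 := (hR'2.trans_le (min_le_right _ _)).le
    have h1 := hstep R' hR'1.le hR'c hgood
    have h2 : dist (Ψ R') (Ψ R) < ε := hδΨ (by rw [Real.dist_eq, abs_lt]; constructor <;> linarith)
    rw [Real.dist_eq, abs_lt] at h2
    linarith [h2.2]
  -- numerics: `Ψ(R) ≤` the printed shape with `3.777`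
  have hpow : (1.8579 * R) ^ (3 / 2 : ℝ) ≤ 2.5325 * R ^ (3 / 2 : ℝ) := by
    rw [Real.mul_rpow (by norm_num) hR.le]
    refine mul_le_mul_of_nonneg_right ?_ (by positivity)
    have e : (1.8579 : ℝ) ^ (3 / 2 : ℝ) = 1.8579 * Real.sqrt 1.8579 := by
      rw [show (3 / 2 : ℝ) = 1 + 1 / 2 by norm_num, Real.rpow_add (by norm_num), Real.rpow_one,
        Real.sqrt_eq_rpow]
    rw [e]
    have hs : Real.sqrt 1.8579 ≤ 1.36305 := by
      rw [Real.sqrt_le_left (by norm_num)]; norm_num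
    nlinarith [Real.sqrt_nonneg 1.8579]
  have hR32 : 0 ≤ R ^ (3 / 2 : ℝ) := by positivity
  have hpole : 0.6421 * R ^ 2 / t ^ 2 ≤ 0.6421 / 160000 := by
    rw [div_le_div_iff₀ (by positivity) (by norm_num)]
    have h1 : R ^ 2 ≤ 1 / 16 := by nlinarith
    have h2 : (10000 : ℝ) ≤ t ^ 2 := by nlinarith
    nlinarith
  have hBt : B * (1.8579 * R) ^ (3 / 2 : ℝ) * L ≤ B * (2.5325 * R ^ (3 / 2 : ℝ)) * L :=
    mul_le_mul_of_nonneg_right (mul_le_mul_of_nonneg_left hpow hB) hL0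
  have hΨR : Ψ R ≤ 1.3478 * R ^ (3 / 2 : ℝ) * B * L + 3.777 + (Real.log A - Real.log R + 2 / 3 * LL) / 1.879 := by
    have e : Ψ R = (1 / 0.6421 - 0.6903 / 5) / 0.3758 + (0.6421 * R ^ 2 / t ^ 2) / 0.3758
        + (1 / (5 * 0.3758)) * (B * (1.8579 * R) ^ (3 / 2 : ℝ) * L)
        + (Real.log A - Real.log R + 2 / 3 * LL) / (5 * 0.3758) := by
      rw [hΨ]; field_simp; ring
    rw [e]
    have hc1 : (1 / 0.6421 - 0.6903 / 5) / 0.3758 + (0.6421 / 160000) / 0.3758 ≤ (3.777 : ℝ) := by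
      norm_num
    have hc2 : (1 / (5 * 0.3758)) * (B * (2.5325 * R ^ (3 / 2 : ℝ)) * L)
        ≤ 1.3478 * R ^ (3 / 2 : ℝ) * B * L := by
      have : 0 ≤ R ^ (3 / 2 : ℝ) * B * L := by positivity
      have hc : (2.5325 / (5 * 0.3758) : ℝ) ≤ 1.3478 := by norm_num
      nlinarith
    have hc3 : (Real.log A - Real.log R + 2 / 3 * LL) / (5 * 0.3758)
        = (Real.log A - Real.log R + 2 / 3 * LL) / 1.879 := by norm_num
    have hc4 : (0.6421 * R ^ 2 / t ^ 2) / 0.3758 ≤ (0.6421 / 160000) / 0.3758 :=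
      div_le_div_of_nonneg_right hpole (by norm_num)
    have hc5 : (1 / (5 * 0.3758)) * (B * (1.8579 * R) ^ (3 / 2 : ℝ) * L)
        ≤ (1 / (5 * 0.3758)) * (B * (2.5325 * R ^ (3 / 2 : ℝ)) * L) :=
      mul_le_mul_of_nonneg_left hBt (by norm_num)
    linarith
  exact hmain.trans hΨR

/-- **Mossinghoff–Trudgian–Yang, Lemma 4.5 (Ford's Lemma 4.2), proved** (constant `3.777`, see
`VinogradovKorobovNearZeroCount.lean`): if `RichertBound A B` holds with `A ≥ 6`, `B ≥ 0`, then for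
`t ≥ 100` and `0 < R ≤ 1/4`,
`N(t, R) ≤ 1.3478 R^{3/2} B log t + 3.777 + (log A − log R + (2/3) log log t)/1.879`
(`mty_lemma_4_5_of_cot` with Ford's (4.2) supplied by `ford_re_cot_ge`). This is the hypothesis
`h45` (with `c45 = 3.777`) of `FarZeros.mty_lemma_4_6_with` and of
`zero_inequality_mossinghoff_trudgian_yang_of_hsw_with`.
[cite: MossinghoffTrudgianYangRNT2024, Lemma 4.5] [cite: Ford2002Millennium, Lemma 4.2] -/
theorem mty_lemma_4_5 {A B : ℝ} (hA : 6 ≤ A) (hB : 0 ≤ B) (hRB : RichertBound A B)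
    {t R : ℝ} (ht : 100 ≤ t) (hR : 0 < R) (hR4 : R ≤ 1 / 4) :
    fordN t R ≤ 1.3478 * R ^ (3 / 2 : ℝ) * B * Real.log t + 3.777
      + (Real.log A - Real.log R + 2 / 3 * Real.log (Real.log t)) / 1.879 :=
  mty_lemma_4_5_of_cot hA hB hRB ford_re_cot_ge ht hR hR4

end Literature.NumberTheory.LFunctions
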